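import Mathlib
import Summits.Ventures.PercRepro2.Defs
import Summits.Ventures.PercRepro2.Independence
import Summits.Ventures.PercRepro2.Harris
import Summits.Ventures.PercRepro2.Graph
import Summits.Ventures.PercRepro2.Exploration
import Summits.Ventures.PercRepro2.Events
import Summits.Ventures.PercRepro2.Induced
import Summits.Ventures.PercRepro2.BHK
import Summits.Ventures.PercRepro2.BHKEvents
import Summits.Ventures.PercRepro2.OneEdge
import Summits.Ventures.PercRepro2.RBDefs
import Summits.Ventures.PercRepro2.RBRoot
import Summits.Ventures.PercRepro2.RBRootDefs
import Summits.Ventures.PercRepro2.RBRootEdge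
import Summits.Ventures.PercRepro2.RBRootEdgePin
import Summits.Ventures.PercRepro2.RBRootEdgeMain
import Summits.Ventures.PercRepro2.RBRootIsolated
import Summits.Ventures.PercRepro2.RBTwoMarkers
import Summits.Ventures.PercRepro2.RBLeaf

/-!
# The third vertex itself pendant: the row at `w` is `p_f` times the row at its neighbour
(mine-a g6; MINE-A.md §38, the «pendant-`w`» reduction)

Let the third vertex `w ∉ {s, t, b, o}` have a single edge `f = {w, u}` of nonzero weight
(`u ≠ w`). Then the cluster of `w` is `{w}` when `f` is closed and the cluster of `u` when `f` is
open, and the Rao–Blackwell sum at `w` splits EXACTLY as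

  `rbSum_p(w; X, Y) = (1 − p_f) · P(Q ∩ X) P(Q ∩ Y) / P(Q) + p_f · rbSum_p(u; X, Y)`

(`rbSum_pendant_w`): the `f`-closed atom `{w}` carries `(1 − p_f)` times the unconditioned
product, and the atoms `A ∋ w, u` of `C(w)` ARE the atoms of `C(u)` containing `w`; the atoms of
`C(u)` avoiding `w` are `(1 − p_f)` times the `f`-closed atoms of `C(u)`, whose sum is the sum at
`u` itself by the leaf reduction `RBLeaf.rbSum_prune_leaf` (the pendant `w` pruned from the
cluster of `u`). Hence the slack of both forms at `w` is `p_f` times the slack at `u`, and the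
typed row at `u` gives the typed row at `w` (`RB.RBcross_and_RBsame_of_pendant_w`); in
particular the row holds at every vertex pendant at a vertex of the skeleton-reducible class
(`RB.RBcross_and_RBsame_of_reducible_pendant_w`).
-/

namespace Summit.Ventures.PercRepro2

namespace RBPendantW

open scoped Classical

section Cluster

variable {V : Type*} {E : Type*} (ends : E → Sym2 V) (w u : V)

/-- A cluster event for a set not containing the vertex is empty. -/
lemma clusterEvent_eq_empty_of_notMem {A : Set V} (hw : w ∉ A) :
    clusterEvent ends w A = ∅ := by
  ext ω
  simp only [mem_clusterEvent, Set.mem_empty_iff_false, iff_false]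
  intro hC
  exact hw (hC ▸ mem_cluster_self ends ω w)

/-- With `f = {w, u}` open, `u` lies in the cluster of `w`. -/
lemma mem_cluster_of_open {f : E} (hends : ends f = s(w, u)) {ω : Config E} (hf : ω f = true) :
    u ∈ cluster ends ω w :=
  (mem_cluster).2 (conn_of_openAdj ⟨f, hf, hends⟩)

/-- **Atoms of `C(w)` containing `u` are atoms of `C(u)`**: for `w, u ∈ A`,
`{C(w) = A} = {C(u) = A}`. -/
lemma clusterEvent_eq_of_mem_mem {A : Set V} (hw : w ∈ A) (hu : u ∈ A) :
    clusterEvent ends w A = clusterEvent ends u A := by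
  ext ω
  simp only [mem_clusterEvent]
  constructor
  · intro hC
    have : u ∈ cluster ends ω w := hC ▸ hu
    rw [← hC]
    exact cluster_eq_of_conn (conn_symm ((mem_cluster).1 this))
  · intro hC
    have : w ∈ cluster ends ω u := hC ▸ hw
    rw [← hC]
    exact cluster_eq_of_conn (conn_symm ((mem_cluster).1 this))

/-- `{C(w) = A}` with `u ∉ A` forces `f = {w, u}` closed. -/
lemma clusterEvent_subset_closedEdge_left {f : E} (hends : ends f = s(w, u)) {A : Set V}
    (hu : u ∉ A) : clusterEvent ends w A ⊆ closedEdge f := by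
  intro ω hC
  rw [mem_clusterEvent] at hC
  by_contra hf
  simp only [closedEdge, Set.mem_setOf_eq, Bool.not_eq_false] at hf
  exact hu (hC ▸ mem_cluster_of_open ends w u hends hf)

/-- `{C(u) = A}` with `w ∉ A` forces `f = {w, u}` closed. -/
lemma clusterEvent_subset_closedEdge_right {f : E} (hends : ends f = s(w, u)) {A : Set V}
    (hw : w ∉ A) : clusterEvent ends u A ⊆ closedEdge f := by
  intro ω hC
  rw [mem_clusterEvent] at hC
  by_contra hf
  simp only [closedEdge, Set.mem_setOf_eq, Bool.not_eq_false] at hf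
  have : w ∈ cluster ends ω u :=
    (mem_cluster).2 (conn_symm ((mem_cluster).1 (mem_cluster_of_open ends w u hends hf)))
  exact hw (hC ▸ this)

end Cluster

section Atoms

variable {V : Type*} {E : Type*} [Fintype E] [DecidableEq E] {R : Type*} [Field R]
  (ends : E → Sym2 V) (s t w u : V) (p : E → R)

/-- Under `p[f ↦ 1]` an event inside `closedEdge f` is null. -/
lemma prob_update_one_of_subset_closedEdge {f : E} {S : Set (Config E)} (hS : S ⊆ closedEdge f) :
    prob (Function.update p f 1) S = 0 := by
  rw [← Set.inter_eq_left.2 hS]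
  exact prob_update_one_inter_closedEdge p S f

/-- An atom of `C(w)` avoiding `w` is null. -/
lemma prob_atom_of_notMem (Z X : Set (Config E)) {A : Set V} (hw : w ∉ A) :
    prob p (Z ∩ clusterEvent ends w A ∩ X) = 0 := by
  rw [clusterEvent_eq_empty_of_notMem ends w hw]
  simp only [Set.inter_empty, Set.empty_inter]
  unfold prob
  simp

/-- With every other edge at `w` of weight `0` and `f = {w, u}`: an atom `{C(w) = A}` with
`w ∈ A`, `u ∉ A`, `A ≠ {w}` is null (closing `f` isolates `w`). -/
lemma prob_atom_w_of_notMem_u {f : E} (hz : ∀ e, w ∈ ends e ∧ e ≠ f → p e = 0)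
    (hends : ends f = s(w, u)) (Z X : Set (Config E)) {A : Set V} (hu : u ∉ A) (hA : A ≠ {w}) :
    prob p (Z ∩ clusterEvent ends w A ∩ X) = 0 := by
  rw [RBTwoMarkers.prob_inter_closed_of_zero p (fun e => w ∈ ends e ∧ e ≠ f) hz]
  unfold prob
  refine Finset.sum_eq_zero fun ω _ => ?_
  refine Set.indicator_of_notMem ?_ _
  rintro ⟨⟨⟨_, hC⟩, _⟩, hcl⟩
  have hf : ω f = false := clusterEvent_subset_closedEdge_left ends w u hends hu hC
  have hcl' : ∀ e, w ∈ ends e → ω e = false := by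
    intro e he
    by_cases h : e = f
    · subst h; exact hf
    · exact hcl e ⟨he, h⟩
  rw [mem_clusterEvent] at hC
  exact hA (hC ▸ RBTwoMarkers.cluster_eq_singleton_of_closed ends w hcl')

/-- With every other edge at `w` of weight `0` and `f = {w, u}`, `u ≠ w`: the atom `{C(w) = {w}}`
is `(1 − p_f)` times the `f`-closed law of the event. -/
lemma prob_atom_w_singleton {f : E} (hz : ∀ e, w ∈ ends e ∧ e ≠ f → p e = 0)
    (hends : ends f = s(w, u)) (huw : u ≠ w) (Z X : Set (Config E)) :
    prob p (Z ∩ clusterEvent ends w {w} ∩ X) = (1 - p f) * prob (Function.update p f 0) (Z ∩ X) := by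
  rw [prob_eq_pin p _ f]
  have h1 : prob (Function.update p f 1) (Z ∩ clusterEvent ends w {w} ∩ X) = 0 := by
    refine prob_update_one_of_subset_closedEdge p ?_
    intro ω hω
    exact clusterEvent_subset_closedEdge_left ends w u hends (by simpa using huw) hω.1.2
  have hz0 : ∀ e, w ∈ ends e → Function.update p f 0 e = 0 := by
    intro e he
    by_cases h : e = f
    · subst h; exact Function.update_self _ _ _
    · rw [Function.update_of_ne h]; exact hz e ⟨he, h⟩
  have h0 : prob (Function.update p f 0) (Z ∩ clusterEvent ends w {w} ∩ X) =
      prob (Function.update p f 0) (Z ∩ X) := by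
    rw [RBTwoMarkers.prob_inter_closed_of_zero _ (fun e => w ∈ ends e) hz0,
      RBTwoMarkers.prob_inter_closed_of_zero _ (fun e => w ∈ ends e) hz0 (Z ∩ X)]
    congr 1
    ext ω
    simp only [Set.mem_inter_iff, Set.mem_setOf_eq, mem_clusterEvent]
    constructor
    · rintro ⟨⟨⟨hZ, _⟩, hX⟩, hcl⟩
      exact ⟨⟨hZ, hX⟩, hcl⟩
    · rintro ⟨⟨hZ, hX⟩, hcl⟩
      exact ⟨⟨⟨hZ, RBTwoMarkers.cluster_eq_singleton_of_closed ends w hcl⟩, hX⟩, hcl⟩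
  rw [h1, h0, mul_zero, zero_add]

/-- An atom `{C(u) = A}` with `w ∉ A` is `(1 − p_f)` times the `f`-closed atom. -/
lemma prob_atom_u_of_notMem_w {f : E} (hends : ends f = s(w, u)) (Z X : Set (Config E))
    {A : Set V} (hw : w ∉ A) :
    prob p (Z ∩ clusterEvent ends u A ∩ X) =
      (1 - p f) * prob (Function.update p f 0) (Z ∩ clusterEvent ends u A ∩ X) := by
  rw [prob_eq_pin p _ f]
  have h1 : prob (Function.update p f 1) (Z ∩ clusterEvent ends u A ∩ X) = 0 := by
    refine prob_update_one_of_subset_closedEdge p ?_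
    intro ω hω
    exact clusterEvent_subset_closedEdge_right ends w u hends hw hω.1.2
  rw [h1, mul_zero, zero_add]

end Atoms

section Sum

variable {V : Type*} {E : Type*} [Fintype E] [DecidableEq E] [Fintype V] {R : Type*} [Field R]
  (ends : E → Sym2 V) (s t w u : V)

/-- **The pendant-`w` identity**: if the third vertex `w ∉ {s, t}` has a single edge
`f = {w, u}` of nonzero weight (`u ≠ w`) and `X, Y` are blind to `f` on «other edges at `w`
closed» (with the masses of `Q ∩ X`, `Q ∩ Y`, `Q` equal under `p` and `p[f ↦ 0]`), then
`rbSum_p(w; X, Y) = (1 − p_f) · P(Q ∩ X) P(Q ∩ Y) / P(Q) + p_f · rbSum_p(u; X, Y)`. -/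
theorem rbSum_pendant_w (p : E → R) {f : E}
    (hz : ∀ e, w ∈ ends e ∧ e ≠ f → p e = 0) (hends : ends f = s(w, u)) (huw : u ≠ w)
    (hsw : s ≠ w) (htw : t ≠ w) (X Y : Set (Config E))
    (hX : ∀ ω : Config E, (∀ e, w ∈ ends e ∧ e ≠ f → ω e = false) →
      (Function.update ω f true ∈ X ↔ Function.update ω f false ∈ X))
    (hY : ∀ ω : Config E, (∀ e, w ∈ ends e ∧ e ≠ f → ω e = false) →
      (Function.update ω f true ∈ Y ↔ Function.update ω f false ∈ Y))
    (hX0 : prob (Function.update p f 0) ((connEvent ends s t)ᶜ ∩ X) =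
      prob p ((connEvent ends s t)ᶜ ∩ X))
    (hY0 : prob (Function.update p f 0) ((connEvent ends s t)ᶜ ∩ Y) =
      prob p ((connEvent ends s t)ᶜ ∩ Y))
    (hQ0 : prob (Function.update p f 0) (connEvent ends s t)ᶜ =
      prob p (connEvent ends s t)ᶜ) :
    RBRoot.rbSum p ends s t w X Y =
      (1 - p f) * (prob p ((connEvent ends s t)ᶜ ∩ X) * prob p ((connEvent ends s t)ᶜ ∩ Y) /
        prob p (connEvent ends s t)ᶜ) + p f * RBRoot.rbSum p ends s t u X Y := by
  set Q := (connEvent ends s t)ᶜ with hQ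
  set T₀ : R := prob p (Q ∩ X) * prob p (Q ∩ Y) / prob p Q with hT₀
  -- the three term functions
  obtain ⟨T, hT⟩ : ∃ T : Set V → R, ∀ A : Set V, T A =
      prob p (Q ∩ clusterEvent ends w A ∩ X) * prob p (Q ∩ clusterEvent ends w A ∩ Y) /
        prob p (Q ∩ clusterEvent ends w A) := ⟨fun A => _, fun A => rfl⟩
  obtain ⟨U, hU⟩ : ∃ U : Set V → R, ∀ A : Set V, U A =
      prob p (Q ∩ clusterEvent ends u A ∩ X) * prob p (Q ∩ clusterEvent ends u A ∩ Y) /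
        prob p (Q ∩ clusterEvent ends u A) := ⟨fun A => _, fun A => rfl⟩
  obtain ⟨U₀, hU₀⟩ : ∃ U₀ : Set V → R, ∀ A : Set V, U₀ A =
      prob (Function.update p f 0) (Q ∩ clusterEvent ends u A ∩ X) *
        prob (Function.update p f 0) (Q ∩ clusterEvent ends u A ∩ Y) /
        prob (Function.update p f 0) (Q ∩ clusterEvent ends u A) := ⟨fun A => _, fun A => rfl⟩
  -- the `f`-closed atoms of `C(u)` containing `w` are null
  have hU₀0 : ∀ A : Set V, w ∈ A → U₀ A = 0 := by
    intro A hw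
    rw [hU₀, RBLeaf.prob_update_zero_atom_leaf ends s t u w p hz huw X hw, zero_mul, zero_div]
  -- atoms of `C(u)` avoiding `w`
  have hUnot : ∀ A : Set V, w ∉ A → U A = (1 - p f) * U₀ A := by
    intro A hw
    rw [hU, hU₀, prob_atom_u_of_notMem_w ends w u p hends Q X hw,
      prob_atom_u_of_notMem_w ends w u p hends Q Y hw]
    have := prob_atom_u_of_notMem_w ends w u p hends Q Set.univ hw (A := A)
    simp only [Set.inter_univ] at this
    rw [this]
    exact RBLeaf.mul_div_mul_self' _ _ _ _
  -- the pointwise identity `T A = [A = {w}] (1 − p_f) T₀ + (U A − (1 − p_f) U₀ A)`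
  have key : ∀ A : Set V, T A = (if A = {w} then (1 - p f) * T₀ else 0) + (U A - (1 - p f) * U₀ A) := by
    intro A
    by_cases hA : A = {w}
    · subst hA
      have hu : u ∉ ({w} : Set V) := by simpa using huw
      rw [if_pos rfl, hT, hU, hU₀0 _ (Set.mem_singleton w),
        prob_atom_of_notMem ends u p Q X hu, zero_mul, zero_div, mul_zero, sub_zero, add_zero,
        prob_atom_w_singleton ends w u p hz hends huw Q X,
        prob_atom_w_singleton ends w u p hz hends huw Q Y]
      have := prob_atom_w_singleton ends w u p hz hends huw Q Set.univ
      simp only [Set.inter_univ] at this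
      rw [this, RBLeaf.mul_div_mul_self', hX0, hY0, hQ0]
    · rw [if_neg hA, zero_add]
      by_cases hw : w ∈ A
      · by_cases hu : u ∈ A
        · rw [hT, hU, hU₀0 A hw, mul_zero, sub_zero, clusterEvent_eq_of_mem_mem ends w u hw hu]
        · rw [hT, hU, hU₀0 A hw, mul_zero, sub_zero,
            prob_atom_w_of_notMem_u ends w u p hz hends Q X hu hA, zero_mul, zero_div,
            prob_atom_of_notMem ends u p Q X hu, zero_mul, zero_div]
      · rw [hT, hUnot A hw, prob_atom_of_notMem ends w p Q X hw, zero_mul, zero_div, sub_self]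
  -- sum the identity
  have hsumT : RBRoot.rbSum p ends s t w X Y = ∑ A : Set V, T A :=
    Finset.sum_congr rfl fun A _ => (hT A).symm
  have hsumU : RBRoot.rbSum p ends s t u X Y = ∑ A : Set V, U A :=
    Finset.sum_congr rfl fun A _ => (hU A).symm
  have hsumU₀ : RBRoot.rbSum (Function.update p f 0) ends s t u X Y = ∑ A : Set V, U₀ A :=
    Finset.sum_congr rfl fun A _ => (hU₀ A).symm
  -- the leaf reduction at `u`: the pendant `w` prunes from the cluster of `u`
  have hprune : RBRoot.rbSum p ends s t u X Y = RBRoot.rbSum (Function.update p f 0) ends s t u X Y :=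
    RBLeaf.rbSum_prune_leaf ends s t u w p hz hends huw huw hsw htw X Y hX hY
  rw [hsumT, Finset.sum_congr rfl fun A _ => key A, Finset.sum_add_distrib, Finset.sum_sub_distrib,
    ← Finset.mul_sum, Finset.sum_ite_eq' Finset.univ ({w} : Set V) (fun _ => (1 - p f) * T₀),
    if_pos (Finset.mem_univ _), ← hsumU, ← hsumU₀, ← hprune]
  ring

end Sum

end RBPendantW

namespace RB

open scoped Classical

variable {V : Type*} {E : Type*} [Fintype E] [DecidableEq E] [Fintype V] [DecidableEq V]
  {R : Type*} [Field R] [LinearOrder R] [IsStrictOrderedRing R]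

omit [DecidableEq V] in
/-- **The typed row at a pendant third vertex follows from the row at its neighbour**: if
`w ∉ {s, t, b, o}` has a single nonzero-weight edge `f = {w, u}` (`u ≠ w`) and both forms hold at
`u`, both forms hold at `w` (the slack at `w` is `p_f` times the slack at `u`). -/
theorem RBcross_and_RBsame_of_pendant_w {p : E → R} (hp : IsProbVec p) (ends : E → Sym2 V)
    (o b s t w u : V) {f : E} (hends : ends f = s(w, u)) (huw : u ≠ w) (hws : w ≠ s) (hwt : w ≠ t)
    (hwb : w ≠ b) (hwo : w ≠ o) (huniq : ∀ e, w ∈ ends e → p e ≠ 0 → e = f)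
    (h : RBcross p ends o b s t u ∧ RBsame p ends o b s t u) :
    RBcross p ends o b s t w ∧ RBsame p ends o b s t w := by
  have hz : ∀ e', w ∈ ends e' ∧ e' ≠ f → p e' = 0 := by
    rintro e' ⟨hw, hne⟩
    by_contra hc
    exact hne (huniq e' hw hc)
  obtain ⟨m1, m2, m3, m4, -, -⟩ := RBTwoMarkers.prob_leaf_update_events ends w p hz hends
    s t b o hws.symm hwt.symm hwb.symm hwo.symm 0 (Or.inl rfl)
  have hblind : ∀ (x y : V), x ≠ w → y ≠ w → ∀ ω : Config E,
      (∀ e, w ∈ ends e ∧ e ≠ f → ω e = false) →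
      (Function.update ω f true ∈ connEvent ends x y ↔
        Function.update ω f false ∈ connEvent ends x y) := by
    intro x y hx hy ω hcl
    simp only [mem_connEvent]
    exact RBLeaf.conn_update_leaf ends w hends hcl hx hy
  have hf0 : 0 ≤ p f := hp.nonneg f
  have hf1 : p f ≤ 1 := hp.le_one f
  obtain ⟨hc, hs⟩ := h
  unfold RBcross Qst at hc
  unfold RBsame Qst at hs
  rw [rbSum_eq_rbRoot] at hc hs
  unfold RBcross RBsame Qst
  rw [rbSum_eq_rbRoot, rbSum_eq_rbRoot]
  constructor
  · rw [RBPendantW.rbSum_pendant_w ends s t w u p hz hends huw hws.symm hwt.symm _ _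
      (hblind b s hwb.symm hws.symm) (hblind o t hwo.symm hwt.symm) m2 m4 m1]
    nlinarith [hc]
  · rw [RBPendantW.rbSum_pendant_w ends s t w u p hz hends huw hws.symm hwt.symm _ _
      (hblind b s hwb.symm hws.symm) (hblind o s hwo.symm hws.symm) m2 m3 m1]
    nlinarith [hs]

end RB

end Summit.Ventures.PercRepro2
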